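import Literature.NumberTheory.EllipticCurves.BSDSelmerCMPConverseRankOneProofs
import Literature.NumberTheory.EllipticCurves.BSDSelmerPConverseRankZeroProofs

/-!
# The lower-bound half of rank-BSD is layered by the algebraic rank; its two lowest layers are the finiteness of `Ш` in rank `0` and in rank `≤ 1`

Write `a = ord_{s=1} L(E,s)` (`analyticRank`) and `r = rank E(ℚ)` (`mordellWeilRank`).
Gross–Zagier–Kolyvagin (`rank_eq_analyticRank_of_analyticRank_le_one`: `a ≤ 1 ⟹ r = a ∧ Ш finite`)
settles every curve with `a ≤ 1`, so the lower-bound half `a ≤ r` of the rank conjecture is open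
exactly in the regime `a ≥ 2` ("vanishing of `L(E,s)` to order `≥ 2` at `s = 1` forces enough
rational points").  This file records, over named published facts only, that this half is LAYERED
by the algebraic rank, that its two lowest layers are purely algebraic statements about `Ш`, and
that it already contains the whole rank conjecture for curves of rank `≤ 1`:

* `one_le_rank_of_two_le_analyticRank_iff_finite_shaPrimary_of_rank_zero` (per curve, per prime):
  at a good ordinary `p ≥ 5` with `E[p]` irreducible on a global minimal model,
  `(a ≥ 2 → r ≥ 1) ↔ (r = 0 → Ш(E)[p^∞] finite)`;
* `two_le_rank_of_two_le_analyticRank_iff_finite_shaPrimary_of_rank_le_one` (per curve, per prime,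
  granting the corank-one `p`-converse at `p`): `(a ≥ 2 → r ≥ 2) ↔ (r ≤ 1 → Ш(E)[p^∞] finite)`;
* `forall_one_le_rank_of_two_le_analyticRank_iff` —
  `(∀ E, a ≥ 2 → r ≥ 1) ↔ (∀ E, r = 0 → Ш(E) finite)`:
  **producing a point of infinite order on every `E/ℚ` with `L(E,1) = L′(E,1) = 0` is EQUIVALENT
  to the finiteness of `Ш(E/ℚ)` for every `E/ℚ` of rank `0`** (below Gross–Zagier–Kolyvagin,
  modularity, Mazur's main conjecture in the Burungale–Castella–Skinner form and
  Perrin-Riou–Schneider, i.e. below the rank-zero `p`-converse);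
* `forall_rank_ne_one_of_two_le_analyticRank_iff` —
  `(∀ E, a ≥ 2 → r ≠ 1) ↔ (∀ E, r = 1 → Ш(E) finite)` (below GZK and the rank-one `p`-converses
  of Kim and Burungale–Tian);
* `forall_two_le_rank_of_two_le_analyticRank_iff` — the conjunction:
  `(∀ E, a ≥ 2 → r ≥ 2) ↔ (∀ E, r ≤ 1 → Ш(E) finite)`;
* `analyticRank_eq_rank_of_rank_le_one_of_lowerBound` — the full lower-bound half
  `∀ E, a ≥ 2 → a ≤ r` alone already gives `a = r` for every curve of rank `≤ 1` (pure logic over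
  GZK), so in the decomposition "rank-BSD ⟺ (upper bound on `r ≥ 3 ∧ a ≥ 2`) ∧ (lower bound on
  `a ≥ 2`)" the low-rank cells `r = 0 ⟹ a = 0`, `r = 1 ⟹ a = 1` are not additional conjuncts:
  they are the two lowest layers of the lower-bound half.

Nothing here is deep; the point is the bookkeeping: the weakest open instance of "higher-order
vanishing ⟹ points", namely `L(E,1) = L′(E,1) = 0 ⟹ E(ℚ) infinite`, and the weakest open instance
of the Tate–Shafarevich conjecture, namely `rank E(ℚ) = 0 ⟹ Ш(E)[p^∞] finite at one good ordinary
p ≥ 5 with E[p] irreducible`, are ONE statement.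

References: B. Gross, D. Zagier, Invent. Math. 84 (1986); V. Kolyvagin, in: The Grothendieck
Festschrift II (1990); R. Greenberg, LNM 1716 (1999), §1 and Thm. 4.1 (rank-zero `p`-converse from
the main conjecture); A. Burungale, F. Castella, C. Skinner, *Base change and Iwasawa main
conjectures for GL₂*, IMRN (2025) = arXiv:2405.00270, Thm. 1.1.2 (a) and Cor. 1.3.1; C.-H. Kim,
Math. Ann. 387 (2022), diagram (1.1) and Cor. 1.4; A. Burungale, Y. Tian, Invent. Math. 220 (2020),
Thm. 1.2; J.-P. Serre, Invent. Math. 15 (1972) / *AEC* IX.6.3 (auxiliary prime).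
-/

open scoped Classical
open WeierstrassCurve Literature.NumberTheory.EllipticCurves.ModularForms

namespace Literature.NumberTheory.EllipticCurves

/-! ### Per curve and per prime -/

section PerPrime

variable (W : WeierstrassCurve ℚ) [W.IsElliptic] [W.IsGloballyMinimal] (p : ℕ) [Fact p.Prime]

/-- **Rank-zero layer, per curve and per prime.** At a good ordinary `p ≥ 5` with `E[p]`
irreducible (global minimal model): "`ord_{s=1} L ≥ 2 ⟹ rank ≥ 1`" for `E` is equivalent to
"`rank = 0 ⟹ Ш(E)[p^∞] finite`" for `E`.  (`→`: if `r = 0` then `a ≤ 1`, so GZK gives `a = 0` and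
`Ш` finite; `←`: if `a ≥ 2` and `r = 0` then `corank Sel_{p^∞} = r + corank Ш[p^∞] = 0`, and the
rank-zero `p`-converse — main conjecture + Schneider's `f_E(0) ≠ 0` + interpolation — gives
`a = 0`.) [cite: GreenbergLNM1716, §1 pp. 65–66 and Thm. 4.1]
[cite: BurungaleCastellaSkinner2025, Thm. 1.1.2 (a)] [cite: Darmon2004, Thm. 3.22] -/
theorem one_le_rank_of_two_le_analyticRank_iff_finite_shaPrimary_of_rank_zero
    (hGZK : rank_eq_analyticRank_of_analyticRank_le_one)
    (hmod : exists_isNewformOf) (hMC : burungale_castella_skinner_charIdeal_eq_padicLFunction)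
    (hS : Schneider1985_order_charGenerator)
    (hp : 5 ≤ p) (hgood : W.HasGoodReductionAtPrime p) (hord : ¬ (p : ℤ) ∣ W.frobeniusTrace p)
    (hirr : W.HasIrreducibleModPGaloisRep p) :
    (2 ≤ W.analyticRank → 1 ≤ W.mordellWeilRank) ↔
      (W.mordellWeilRank = 0 → Finite (AddCommGroup.primaryComponent W.sha p)) := by
  constructor
  · intro h hr
    have ha : W.analyticRank ≤ 1 := by
      by_contra ha
      have h1 := h (by omega)
      omega
    haveI : Finite W.sha := (hGZK W ha).2
    infer_instance
  · intro h ha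
    by_contra hr
    have hr0 : W.mordellWeilRank = 0 := by omega
    have hcorank : W.selmerCorank p = 0 := by
      rw [W.selmerCorank_eq_mordellWeilRank_add_holds p, hr0, zero_add]
      exact (finite_primaryComponent_sha_iff_shaCorank_eq_zero W p).1 (h hr0)
    have h0 := analyticRank_eq_zero_of_selmerCorank_eq_zero_of_mainConjecture hmod hMC hS W p hp
      hgood hord hirr hcorank
    omega

/-- **Rank-`≤ 1` layer, per curve and per prime.** At a good ordinary `p ≥ 5` with `E[p]`
irreducible (global minimal model), granting the corank-one `p`-converse `corank Sel_{p^∞} = 1 ⟹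
ord = 1` for this curve at `p` (Skinner 2020 Thm. A′; Burungale–Skinner–Tian–Wan; Kim 2022 Cor. 1.4;
Burungale–Tian for CM): "`ord_{s=1} L ≥ 2 ⟹ rank ≥ 2`" for `E` is equivalent to
"`rank ≤ 1 ⟹ Ш(E)[p^∞] finite`" for `E`. [cite: Skinner2020, Thm. A′] [cite: Kim2022, Cor. 1.4]
[cite: GreenbergLNM1716, §1 pp. 65–66] [cite: Darmon2004, Thm. 3.22] -/
theorem two_le_rank_of_two_le_analyticRank_iff_finite_shaPrimary_of_rank_le_one
    (hGZK : rank_eq_analyticRank_of_analyticRank_le_one)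
    (hmod : exists_isNewformOf) (hMC : burungale_castella_skinner_charIdeal_eq_padicLFunction)
    (hS : Schneider1985_order_charGenerator)
    (hp : 5 ≤ p) (hgood : W.HasGoodReductionAtPrime p) (hord : ¬ (p : ℤ) ∣ W.frobeniusTrace p)
    (hirr : W.HasIrreducibleModPGaloisRep p)
    (hconv1 : W.selmerCorank p = 1 → W.analyticRank = 1) :
    (2 ≤ W.analyticRank → 2 ≤ W.mordellWeilRank) ↔
      (W.mordellWeilRank ≤ 1 → Finite (AddCommGroup.primaryComponent W.sha p)) := by
  constructor
  · intro h hr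
    have ha : W.analyticRank ≤ 1 := by
      by_contra ha
      have h1 := h (by omega)
      omega
    haveI : Finite W.sha := (hGZK W ha).2
    infer_instance
  · intro h ha
    by_contra hr
    have hs : W.selmerCorank p = W.mordellWeilRank := by
      rw [W.selmerCorank_eq_mordellWeilRank_add_holds p,
        (finite_primaryComponent_sha_iff_shaCorank_eq_zero W p).1 (h (by omega)), add_zero]
    have hconv0 : W.selmerCorank p = 0 → W.analyticRank = 0 :=
      analyticRank_eq_zero_of_selmerCorank_eq_zero_of_mainConjecture hmod hMC hS W p hp hgood hord hirr
    by_cases h0 : W.selmerCorank p = 0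
    · have := hconv0 h0; omega
    by_cases h1 : W.selmerCorank p = 1
    · have := hconv1 h1; omega
    omega

end PerPrime

/-! ### Universal forms: the layers of "`a ≥ 2 ⟹ a ≤ r`" are `Ш`-finiteness statements -/

section Universal

/-- Rank-zero `p`-converse for every `E/ℚ` (any model): `rank E(ℚ) = 0 ∧ Ш(E) finite ⟹
ord_{s=1} L(E,s) = 0` — global minimal model, an auxiliary good ordinary `p ≥ 5` with `E[p]`
irreducible (tree theorem), then `analyticRank_eq_zero_of_selmerCorank_eq_zero_of_mainConjecture`.
[cite: GreenbergLNM1716, §1 pp. 65–66 and Thm. 4.1] [cite: BurungaleCastellaSkinner2025, Thm. 1.1.2 (a)] -/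
theorem analyticRank_eq_zero_of_rank_eq_zero_of_finite_sha
    (hmod : exists_isNewformOf) (hMC : burungale_castella_skinner_charIdeal_eq_padicLFunction)
    (hS : Schneider1985_order_charGenerator)
    (W : WeierstrassCurve ℚ) [W.IsElliptic] (hrank : W.mordellWeilRank = 0) (hsha : Finite W.sha) :
    W.analyticRank = 0 := by
  obtain ⟨C, hC⟩ := hasGlobalMinimalModel_rat_holds W
  obtain ⟨p, hgt, ⟨hp, hgood, hord⟩, hirr⟩ :=
    (C • W).exists_gt_mem_goodOrdinaryPrimes_hasIrreducibleModPGaloisRep 4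
  have hrank' : (C • W).mordellWeilRank = 0 := by
    have h : (C • W).mordellWeilRank = W.mordellWeilRank := mordellWeilRank_variableChange_holds W C
    rw [h, hrank]
  haveI : Finite (C • W).sha := (Equiv.finite_iff (shaEquiv W C)).mp hsha
  have hshap : Finite (AddCommGroup.primaryComponent (C • W).sha p) := inferInstance
  have hcorank : (C • W).selmerCorank p = 0 := by
    rw [(C • W).selmerCorank_eq_mordellWeilRank_add_holds p, hrank', zero_add]
    exact (finite_primaryComponent_sha_iff_shaCorank_eq_zero (C • W) p).1 hshap
  have h0 := analyticRank_eq_zero_of_selmerCorank_eq_zero_of_mainConjecture hmod hMC hS (C • W) p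
    (by omega) hgood hord hirr hcorank
  rwa [analyticRank_smul] at h0

/-- **The rank-zero layer.** Below GZK and the rank-zero `p`-converse:
`(∀ E/ℚ, ord_{s=1} L(E,s) ≥ 2 ⟹ rank E(ℚ) ≥ 1) ↔ (∀ E/ℚ, rank E(ℚ) = 0 ⟹ Ш(E/ℚ) finite)`.
In words: to produce a rational point of infinite order on every elliptic curve over `ℚ` with
`L(E,1) = L′(E,1) = 0` is the same problem as to prove `Ш` finite for every curve of rank zero.
[cite: Darmon2004, Thm. 3.22] [cite: GreenbergLNM1716, §1 pp. 65–66] -/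
theorem forall_one_le_rank_of_two_le_analyticRank_iff
    (hGZK : rank_eq_analyticRank_of_analyticRank_le_one)
    (hmod : exists_isNewformOf) (hMC : burungale_castella_skinner_charIdeal_eq_padicLFunction)
    (hS : Schneider1985_order_charGenerator) :
    (∀ W : WeierstrassCurve ℚ, W.IsElliptic → 2 ≤ W.analyticRank → 1 ≤ W.mordellWeilRank) ↔
      (∀ W : WeierstrassCurve ℚ, W.IsElliptic → W.mordellWeilRank = 0 → Finite W.sha) := by
  constructor
  · intro h W hE hr
    have ha : W.analyticRank ≤ 1 := by
      by_contra ha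
      have h1 := h W hE (by omega)
      omega
    exact (hGZK W ha).2
  · intro h W hE ha
    by_contra hr
    have hr0 : W.mordellWeilRank = 0 := by omega
    have h0 := analyticRank_eq_zero_of_rank_eq_zero_of_finite_sha hmod hMC hS W hr0 (h W hE hr0)
    omega

/-- **The rank-one layer.** Below GZK and the rank-one `p`-converses (Kim; Burungale–Tian):
`(∀ E/ℚ, ord_{s=1} L(E,s) ≥ 2 ⟹ rank E(ℚ) ≠ 1) ↔ (∀ E/ℚ, rank E(ℚ) = 1 ⟹ Ш(E/ℚ) finite)`.
[cite: Kim2022, §1 diagram (1.1) and Cor. 1.4] [cite: BurungaleTian2019, main theorem (§1)]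
[cite: Darmon2004, Thm. 3.22] -/
theorem forall_rank_ne_one_of_two_le_analyticRank_iff
    (hGZK : rank_eq_analyticRank_of_analyticRank_le_one)
    (hKim : kim_analyticRank_eq_one_of_mordellWeilRank_eq_one)
    (hBT : burungaleTian_analyticRank_eq_one_of_selmerCorank_eq_one_of_hasCM) :
    (∀ W : WeierstrassCurve ℚ, W.IsElliptic → 2 ≤ W.analyticRank → W.mordellWeilRank ≠ 1) ↔
      (∀ W : WeierstrassCurve ℚ, W.IsElliptic → W.mordellWeilRank = 1 → Finite W.sha) := by
  constructor
  · intro h W hE hr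
    have ha : W.analyticRank ≤ 1 := by
      by_contra ha
      exact h W hE (by omega) hr
    exact (hGZK W ha).2
  · intro h W hE ha hr
    have h1 := analyticRank_eq_one_of_mordellWeilRank_eq_one_of_finite_sha hKim hBT W hr (h W hE hr)
    omega

/-- **The two lowest layers together.** Below GZK and the rank-`≤ 1` `p`-converses:
`(∀ E/ℚ, ord_{s=1} L(E,s) ≥ 2 ⟹ rank E(ℚ) ≥ 2) ↔ (∀ E/ℚ, rank E(ℚ) ≤ 1 ⟹ Ш(E/ℚ) finite)` —
the Tate–Shafarevich conjecture in algebraic rank `≤ 1` IS the statement that second-order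
vanishing forces two independent points. [cite: Kim2022, §1 diagram (1.1)]
[cite: GreenbergLNM1716, §1 pp. 65–66] [cite: Darmon2004, Thm. 3.22] -/
theorem forall_two_le_rank_of_two_le_analyticRank_iff
    (hGZK : rank_eq_analyticRank_of_analyticRank_le_one)
    (hKim : kim_analyticRank_eq_one_of_mordellWeilRank_eq_one)
    (hBT : burungaleTian_analyticRank_eq_one_of_selmerCorank_eq_one_of_hasCM)
    (hmod : exists_isNewformOf) (hMC : burungale_castella_skinner_charIdeal_eq_padicLFunction)
    (hS : Schneider1985_order_charGenerator) :
    (∀ W : WeierstrassCurve ℚ, W.IsElliptic → 2 ≤ W.analyticRank → 2 ≤ W.mordellWeilRank) ↔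
      (∀ W : WeierstrassCurve ℚ, W.IsElliptic → W.mordellWeilRank ≤ 1 → Finite W.sha) := by
  constructor
  · intro h W hE hr
    have ha : W.analyticRank ≤ 1 := by
      by_contra ha
      have h2 := h W hE (by omega)
      omega
    exact (hGZK W ha).2
  · intro h W hE ha
    have h1 : 1 ≤ W.mordellWeilRank :=
      (forall_one_le_rank_of_two_le_analyticRank_iff hGZK hmod hMC hS).2
        (fun W hE hr => h W hE (by omega)) W hE ha
    have h2 : W.mordellWeilRank ≠ 1 :=
      (forall_rank_ne_one_of_two_le_analyticRank_iff hGZK hKim hBT).2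
        (fun W hE hr => h W hE (by omega)) W hE ha
    omega

/-- **The lower-bound half contains the low-rank cells.** Over Gross–Zagier–Kolyvagin alone: if
`ord_{s=1} L ≥ 2 ⟹ ord ≤ rank` for every `E/ℚ`, then `ord = rank` for every `E/ℚ` of rank `≤ 1`
(pure logic: for such a curve `ord ≥ 2` is impossible, and `ord ≤ 1` gives `rank = ord`).  Hence,
in the cell decomposition of the rank conjecture, the cells `rank = 0 ⟹ ord = 0` and
`rank = 1 ⟹ ord = 1` are consequences of the lower-bound half, not extra conjuncts.
[cite: Darmon2004, Thm. 3.22] -/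
theorem analyticRank_eq_rank_of_rank_le_one_of_lowerBound
    (hGZK : rank_eq_analyticRank_of_analyticRank_le_one)
    (hlow : ∀ W : WeierstrassCurve ℚ, W.IsElliptic → 2 ≤ W.analyticRank →
      W.analyticRank ≤ W.mordellWeilRank)
    (W : WeierstrassCurve ℚ) [hE : W.IsElliptic] (hr : W.mordellWeilRank ≤ 1) :
    W.analyticRank = W.mordellWeilRank := by
  by_cases ha : W.analyticRank ≤ 1
  · exact (hGZK W ha).1.symm
  · have h := hlow W hE (by omega)
    omega

/-- **Rank-BSD for curves of rank `≤ 1` and for curves of order `≥ 2`, from the lower-bound half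
and the deep upper bound.** Over GZK: the lower-bound half `ord ≥ 2 ⟹ ord ≤ rank` together with the
upper bound in the deep regime `rank ≥ 3 ∧ ord ≥ 2 ⟹ rank ≤ ord` gives `ord = rank` for every
`E/ℚ` (the case `rank = 2 ∧ ord ≥ 2` closes because `ord ≤ rank = 2 ≤ ord`).  This is the two-wall
form of the rank conjecture: no separate low-rank conjunct is needed. [cite: Darmon2004, Thm. 3.22] -/
theorem analyticRank_eq_rank_of_lowerBound_of_upperBoundDeep
    (hGZK : rank_eq_analyticRank_of_analyticRank_le_one)
    (hlow : ∀ W : WeierstrassCurve ℚ, W.IsElliptic → 2 ≤ W.analyticRank →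
      W.analyticRank ≤ W.mordellWeilRank)
    (hup : ∀ W : WeierstrassCurve ℚ, W.IsElliptic → 3 ≤ W.mordellWeilRank → 2 ≤ W.analyticRank →
      W.mordellWeilRank ≤ W.analyticRank)
    (W : WeierstrassCurve ℚ) [hE : W.IsElliptic] : W.analyticRank = W.mordellWeilRank := by
  by_cases ha : W.analyticRank ≤ 1
  · exact (hGZK W ha).1.symm
  · have h1 := hlow W hE (by omega)
    by_cases hr : W.mordellWeilRank ≤ 2
    · omega
    · have h2 := hup W hE (by omega) (by omega)
      omega

end Universal

end Literature.NumberTheory.EllipticCurves
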